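import Literature.IUT.HodgeTheaters.KappaCoricRatGaloisLocal
import Literature.IUT.HodgeTheaters.Ex54ivInfKappaArithRatGalois
import HarnessLib

/-!
# [IUTchI] Definition 5.2 (v)/(vii), Remark 3.1.7 (i), (ii): the local `∞κ`-coric KIT at one place — the INHABITANT
# (GAP B = G-L5t9g8-1, item GB-02 = GAP-SIZING-B.md row D2; companion of `KappaCoricRatGaloisLocal.lean`)

S. Mochizuki, *Inter-universal Teichmüller theory I*, kurims manuscript (May 2020), Definition 5.2 (v) p. 135,
(vii) p. 139, Remark 3.1.7 (i), (ii) pp. 66–67 ([IUTchI] Def 5.2 (v) p.135) [claim: Mochizuki2012, status: disputed]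
(D-0012 claim key, series status DISPUTED — a construction at OUR model presentation; nothing of the series is
asserted; no side is taken on [IUTchIII] Cor. 3.12).

## What is built (the mathematics that the TYPE file defers)

For a field `L` of characteristic `0`, an `L`-rational strictly critical locus `S : CriticalLocus L` and a unit
parameter `U ⊆ L` (print: `U_L = 𝒪_L^×`), with `Λ_L`, `G_L^{rat} = Gal(Λ_L/L(t))`, `L̄ ⊂ Λ_L`, `L̄(t) ↪ Λ_L` and the
carriers `𝕄_{∞κv} ⊆ 𝕄_{∞κ×v} ⊆ Λ_L` of the TYPE file:

1. **Conjugation.** `σ ∈ G_L^{rat}` restricts to `τ_σ ∈ Gal(L̄/L)` on the geometric constants (`L̄/L` is normal;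
   Mathlib `AlgEquiv.restrictNormal`), and `σ` acts on a geometric rational function `g ∈ L̄(t)` by conjugating its
   coefficients: `σ(g) = g^{τ_σ}` (`smul_geomEmb`), where `g^τ := num(g)^τ / denom(g)^τ` (`conjRat`) has
   `num (g^τ) = num(g)^τ`, `denom (g^τ) = denom(g)^τ`.
2. **`κ`-coricity is conjugation-invariant** for an `L`-RATIONAL critical locus (`isKappaCoric_conjRat`): the zero /
   pole sets over `L̄` are permuted by `τ` (so «precisely one pole, at least two zeroes» and algebraicity of the divisor
   are kept), the critical points are FIXED by `τ` (so avoidance and «restricts to a root of unity at every strictly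
   critical point» are kept).  [This is where the geometric typing of RULINGS #318 pays: the statement is about
   divisors over `L̄`, on which `Gal(L̄/L)` acts; a divisor count over `L` itself would not be base-change stable.]
3. Hence `𝕄_{∞κv}` and `𝕄_{∞κ×v}` are `G_L^{rat}`-STABLE (`smul_mem_minfkSet`, `smul_mem_minfkxSet`) — exactly the
   «`G`-stability of the coric set» that GAP B item GB-01 (`Ex54ivInfKappaArithRatGalois.lean`, p666587) names as
   the missing input for the ARITHMETIC group to act on GEOMETRICALLY typed divisors; the pair is then packaged
   with GB-01's constructor `CoricPair.ofStableSet` BY NAME (open stabilisers in the Krull topology, field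
   multiplication restricted to the carrier, §0 pseudo-monoid realised in `Λ_Lˣ` since `0 ∉ 𝕄_{∞κ×v}`).
4. **The kit** `CriticalLocus.infKappaCoricKit S U : InfKappaCoricKit (ratGalois L)` — the deliverable named in
   GAP-SIZING-B.md row D2 («t4-shape kit `def CriticalLocus.infKappaCoricKit (S) (L_v) (U := units)` with
   `Minfk ⊆ Minfkx`») — and its bundled form `LocalInfKappaLayer.ofField L S U`.

All statements PROVED (field theory over Mathlib); no instance, no notation, no axiom, no `sorry`.  MODEL
presentation (abc-iut-L5-lead RULINGS #316 (i)); typed/built ≠ proved-in-print; count-neutral until the chair tokens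
the row; nothing here asserts that abc is proved or refuted.
-/

noncomputable section

namespace Literature.IUT.HodgeTheaters

open Polynomial
open scoped RatFunc Classical

universe u

namespace CriticalLocus

/-! ### 0. Two polynomial lemmas -/

section Poly

variable {K : Type u} [Field K]

/-- In a field of rational functions, a fraction `p/q` with `p`, `q` coprime and `q` monic is in normal form:
`num (p/q) = p` and `denom (p/q) = q`. ([IUTchI] Rmk 3.1.7 (i) p.66) [claim: Mochizuki2012, status: disputed] -/
theorem num_denom_div_of_isCoprime {p q : K[X]} (hpq : IsCoprime p q) (hq : q.Monic) :
    (algebraMap K[X] (RatFunc K) p / algebraMap K[X] (RatFunc K) q).num = p ∧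
      (algebraMap K[X] (RatFunc K) p / algebraMap K[X] (RatFunc K) q).denom = q := by
  set x := algebraMap K[X] (RatFunc K) p / algebraMap K[X] (RatFunc K) q with hx
  have hq0 : q ≠ 0 := hq.ne_zero
  have hrel : x.num * q = p * x.denom := (RatFunc.num_mul_eq_mul_denom_iff hq0).mpr hx
  have h1 : x.denom ∣ q := by
    have : x.denom ∣ x.num * q := ⟨p, by rw [hrel, mul_comm]⟩
    exact (RatFunc.isCoprime_num_denom x).symm.dvd_of_dvd_mul_left this
  have h2 : q ∣ x.denom := by
    have : q ∣ p * x.denom := ⟨x.num, by rw [← hrel, mul_comm]⟩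
    exact hpq.symm.dvd_of_dvd_mul_left this
  have hden : x.denom = q :=
    Polynomial.eq_of_monic_of_associated (RatFunc.monic_denom x) hq (associated_of_dvd_dvd h1 h2)
  refine ⟨?_, hden⟩
  rw [hden] at hrel
  exact mul_right_cancel₀ hq0 hrel

/-- The roots of `p^τ` are the `τ`-images of the roots of `p`, for a field AUTOMORPHISM `τ` (no splitting
hypothesis). ([IUTchI] Rmk 3.1.7 (i) p.66) [claim: Mochizuki2012, status: disputed] -/
theorem roots_map_of_leftInverse {f g : K →+* K} (hfg : Function.LeftInverse g f) (hgf : Function.LeftInverse f g)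
    (p : K[X]) : (p.map f).roots = p.roots.map f := by
  by_cases hp : p = 0
  · subst hp; simp
  apply le_antisymm
  · have hq : p.map f ≠ 0 := (Polynomial.map_ne_zero_iff f.injective).mpr hp
    have h1 : (p.map f).roots.map g ≤ p.roots := by
      have := Polynomial.map_roots_le (f := g) ((Polynomial.map_ne_zero_iff g.injective).mpr hq)
      rw [Polynomial.map_map] at this
      have hcomp : g.comp f = RingHom.id K := RingHom.ext fun a => hfg a
      rwa [hcomp, Polynomial.map_id] at this
    have h2 := Multiset.map_le_map (f := (f : K → K)) h1
    rw [Multiset.map_map] at h2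
    have hid : ((f : K → K) ∘ (g : K → K)) = id := funext fun a => hgf a
    rwa [hid, Multiset.map_id] at h2
  · exact Polynomial.map_roots_le ((Polynomial.map_ne_zero_iff f.injective).mpr hp)

end Poly

variable (L : Type u) [Field L]

/-! ### 1. Conjugation of geometric rational functions by `G_L^{rat}` -/

/-- The restriction of `σ ∈ Gal(Λ_L/L(t))` to the geometric constants: `τ_σ ∈ Gal(L̄/L)` (`L̄/L` is normal).
([IUTchI] Rmk 3.1.7 (i) p.66) [claim: Mochizuki2012, status: disputed] -/
def resConstants (σ : ratGalois L) : geomConstants L ≃ₐ[L] geomConstants L :=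
  (σ.restrictScalars L).restrictNormal (geomConstants L)

/-- `τ_σ` is the restriction of `σ`: `σ c = τ_σ c` for `c ∈ L̄`. ([IUTchI] Rmk 3.1.7 (i) p.66)
[claim: Mochizuki2012, status: disputed] -/
theorem coe_resConstants (σ : ratGalois L) (c : geomConstants L) :
    ((resConstants L σ c : geomConstants L) : ratClosure L) = σ (c : ratClosure L) :=
  AlgEquiv.restrictNormal_commutes (σ.restrictScalars L) (geomConstants L) c

/-- `σ` fixes the coordinate `t`. ([IUTchI] Rmk 3.1.7 (i) p.66) [claim: Mochizuki2012, status: disputed] -/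
theorem smul_ratVar (σ : ratGalois L) : σ (ratVar L) = ratVar L :=
  σ.commutes RatFunc.X

/-- `σ` fixes the constants of `L`. ([IUTchI] Rmk 3.1.7 (i) p.66) [claim: Mochizuki2012, status: disputed] -/
theorem smul_algebraMap_base (σ : ratGalois L) (c : L) :
    σ (algebraMap L (ratClosure L) c) = algebraMap L (ratClosure L) c := by
  rw [IsScalarTower.algebraMap_apply L (RatFunc L) (ratClosure L), σ.commutes]

variable {L}

/-- Conjugation of a geometric rational function by `τ ∈ Gal(L̄/L)`: `g^τ := num(g)^τ / denom(g)^τ` (coefficients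
conjugated). ([IUTchI] Rmk 3.1.7 (i) p.66) [claim: Mochizuki2012, status: disputed] -/
def conjRat (τ : geomConstants L ≃ₐ[L] geomConstants L) (g : RatFunc (geomConstants L)) :
    RatFunc (geomConstants L) :=
  algebraMap _ _ (g.num.map (τ : geomConstants L →+* geomConstants L)) /
    algebraMap _ _ (g.denom.map (τ : geomConstants L →+* geomConstants L))

/-- `num (g^τ) = num(g)^τ` and `denom (g^τ) = denom(g)^τ`. ([IUTchI] Rmk 3.1.7 (i) p.66)
[claim: Mochizuki2012, status: disputed] -/
theorem num_denom_conjRat (τ : geomConstants L ≃ₐ[L] geomConstants L) (g : RatFunc (geomConstants L)) :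
    (conjRat τ g).num = g.num.map (τ : geomConstants L →+* geomConstants L) ∧
      (conjRat τ g).denom = g.denom.map (τ : geomConstants L →+* geomConstants L) := by
  have hcop : IsCoprime (g.num.map (τ : geomConstants L →+* geomConstants L))
      (g.denom.map (τ : geomConstants L →+* geomConstants L)) :=
    (RatFunc.isCoprime_num_denom g).map (Polynomial.mapRingHom (τ : geomConstants L →+* geomConstants L))
  have hmon : (g.denom.map (τ : geomConstants L →+* geomConstants L)).Monic := (RatFunc.monic_denom g).map _
  exact num_denom_div_of_isCoprime hcop hmon

/-- `L̄(t) ↪ Λ_L` on polynomials is evaluation at `t`. ([IUTchI] Rmk 3.1.7 (i) p.66) [claim: Mochizuki2012, status: disputed] -/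
theorem geomEmb_algebraMap (p : (geomConstants L)[X]) :
    geomEmb L (algebraMap _ (RatFunc (geomConstants L)) p) = aeval (ratVar L) p := by
  show (IntermediateField.val _)
      ((RatFunc.algEquivOfTranscendental (ratVar L) (ratVar_transcendental L))
        (algebraMap _ (RatFunc (geomConstants L)) p)) = _
  rw [RatFunc.algEquivOfTranscendental_algebraMap, ← Polynomial.aeval_algHom_apply]
  rfl

/-- `L̄(t) ↪ Λ_L` in terms of numerator and denominator. ([IUTchI] Rmk 3.1.7 (i) p.66) [claim: Mochizuki2012, status: disputed] -/
theorem geomEmb_eq_div (g : RatFunc (geomConstants L)) :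
    geomEmb L g = aeval (ratVar L) g.num / aeval (ratVar L) g.denom := by
  conv_lhs => rw [← RatFunc.num_div_denom g]
  rw [map_div₀, geomEmb_algebraMap, geomEmb_algebraMap]

/-- `σ` acts on the image of a geometric polynomial by conjugating coefficients.
([IUTchI] Rmk 3.1.7 (i) p.66) [claim: Mochizuki2012, status: disputed] -/
theorem smul_aeval_ratVar (σ : ratGalois L) (p : (geomConstants L)[X]) :
    σ (aeval (ratVar L) p) =
      aeval (ratVar L) (p.map (resConstants L σ : geomConstants L →+* geomConstants L)) := by
  have h : (algebraMap (geomConstants L) (ratClosure L)).comp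
      (resConstants L σ : geomConstants L →+* geomConstants L) =
      (σ : ratClosure L →+* ratClosure L).comp (algebraMap (geomConstants L) (ratClosure L)) :=
    RingHom.ext fun c => coe_resConstants L σ c
  have key := Polynomial.map_aeval_eq_aeval_map h p (ratVar L)
  have hσt : (σ : ratClosure L →+* ratClosure L) (ratVar L) = ratVar L := smul_ratVar L σ
  rw [hσt] at key
  exact key

/-- **Conjugation formula**: `σ(g) = g^{τ_σ}` on geometric rational functions `g ∈ L̄(t) ⊂ Λ_L`.
([IUTchI] Rmk 3.1.7 (i) p.66) [claim: Mochizuki2012, status: disputed] -/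
theorem smul_geomEmb (σ : ratGalois L) (g : RatFunc (geomConstants L)) :
    σ (geomEmb L g) = geomEmb L (conjRat (resConstants L σ) g) := by
  rw [geomEmb_eq_div, map_div₀, smul_aeval_ratVar, smul_aeval_ratVar, conjRat, map_div₀,
    geomEmb_algebraMap, geomEmb_algebraMap]

/-- A constant is conjugated to a constant: `(C c)^τ = C (τ c)`. ([IUTchI] Rmk 3.1.7 (i) p.66)
[claim: Mochizuki2012, status: disputed] -/
theorem conjRat_C (τ : geomConstants L ≃ₐ[L] geomConstants L) (c : geomConstants L) :
    conjRat τ (RatFunc.C c) = RatFunc.C (τ c) := by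
  rw [conjRat, RatFunc.num_C, RatFunc.denom_C, Polynomial.map_C, Polynomial.map_one, map_one, div_one,
    RatFunc.algebraMap_C]
  rfl

/-- Evaluation of a conjugated polynomial at a `τ`-FIXED point: `p^τ(e) = τ (p(e))` when `τ e = e`.
([IUTchI] Rmk 3.1.7 (i) p.66) [claim: Mochizuki2012, status: disputed] -/
theorem eval_map_of_fixed (τ : geomConstants L ≃ₐ[L] geomConstants L) (p : (geomConstants L)[X])
    {e : geomConstants L} (he : τ e = e) :
    (p.map (τ : geomConstants L →+* geomConstants L)).eval e = τ (p.eval e) := by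
  conv_lhs => rw [← he]
  rw [Polynomial.eval_map]
  exact Polynomial.eval₂_at_apply (τ : geomConstants L →+* geomConstants L) e

/-- Evaluation commutes with conjugation at a `τ`-FIXED point: `g^τ(e) = τ (g(e))` when `τ e = e`.
([IUTchI] Rmk 3.1.7 (i) p.66) [claim: Mochizuki2012, status: disputed] -/
theorem eval_conjRat_of_fixed (τ : geomConstants L ≃ₐ[L] geomConstants L) (g : RatFunc (geomConstants L))
    {e : geomConstants L} (he : τ e = e) :
    (conjRat τ g).eval (RingHom.id _) e = τ (g.eval (RingHom.id _) e) := by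
  obtain ⟨hn, hd⟩ := num_denom_conjRat τ g
  simp only [RatFunc.eval, hn, hd, Polynomial.eval₂_id, eval_map_of_fixed τ _ he, map_div₀]

/-- The points of an `L`-rational critical locus are fixed by `Gal(L̄/L)`. ([IUTchI] Rmk 3.1.7 (i) p.66)
[claim: Mochizuki2012, status: disputed] -/
theorem toGeom_fixed (S : CriticalLocus L) (τ : geomConstants L ≃ₐ[L] geomConstants L)
    {e : geomConstants L} (he : e ∈ S.toGeom.pts) : τ e = e := by
  obtain ⟨a, -, rfl⟩ := (mem_toGeom_pts_iff S e).mp he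
  exact τ.commutes a

/-- The constants `c ∈ L` inside `Λ_L`, through `L̄(t)`. ([IUTchI] Rmk 3.1.7 (ii) p.67) [claim: Mochizuki2012, status: disputed] -/
theorem geomEmb_C_algebraMap (c : L) :
    geomEmb L (RatFunc.C (algebraMap L (geomConstants L) c)) = algebraMap L (ratClosure L) c := by
  rw [geomEmb_C]
  rfl

/-! ### 2. `κ`-coricity is invariant under conjugation (the critical locus being `L`-rational) -/

variable [CharZero L]

/-- **`κ`-coricity is invariant under `Gal(L̄/L)`-conjugation** when the strictly critical locus is `L`-rational:
zeroes/poles over `L̄` are permuted, the critical points are fixed (Rmk 3.1.7 (i): the three conditions are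
statements about the divisor over `L̄` and values at the critical points). ([IUTchI] Rmk 3.1.7 (i) p.66)
[claim: Mochizuki2012, status: disputed] -/
theorem isKappaCoric_conjRat (S : CriticalLocus L) (τ : geomConstants L ≃ₐ[L] geomConstants L)
    {g : RatFunc (geomConstants L)} (hg : S.toGeom.IsKappaCoric g) : S.toGeom.IsKappaCoric (conjRat τ g) := by
  classical
  obtain ⟨hn, hd⟩ := num_denom_conjRat τ g
  set f : geomConstants L →+* geomConstants L := (τ : geomConstants L →+* geomConstants L) with hf
  have hgf : Function.LeftInverse (τ.symm : geomConstants L →+* geomConstants L) f := fun a => τ.symm_apply_apply a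
  have hfg : Function.LeftInverse f (τ.symm : geomConstants L →+* geomConstants L) := fun a => τ.apply_symm_apply a
  have hfinj : Function.Injective f := f.injective
  have hzer : zeroes (conjRat τ g) = (zeroes g).map ⟨f, hfinj⟩ := by
    ext z
    simp only [zeroes, hn, roots_map_of_leftInverse hgf hfg, Multiset.mem_toFinset, Multiset.mem_map,
      Finset.mem_map, Function.Embedding.coeFn_mk]
  have hpol : poles (conjRat τ g) = (poles g).map ⟨f, hfinj⟩ := by
    ext z
    simp only [poles, hd, roots_map_of_leftInverse hgf hfg, Multiset.mem_toFinset, Multiset.mem_map,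
      Finset.mem_map, Function.Embedding.coeFn_mk]
  refine ⟨?_, ?_, ?_, ?_⟩
  · -- one pole, two zeroes
    intro hc
    have hc' : ∀ c : geomConstants L, g ≠ RatFunc.C c := by
      intro c h
      exact hc (τ c) (by rw [h, conjRat_C])
    obtain ⟨h1, h2⟩ := hg.one_pole_two_zeroes hc'
    rw [hzer, hpol, Finset.card_map, Finset.card_map]
    exact ⟨h1, h2⟩
  · -- divisor algebraic over ℚ
    intro z hz
    rw [hzer, hpol] at hz
    simp only [Finset.mem_union, Finset.mem_map, Function.Embedding.coeFn_mk] at hz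
    have halg : ∀ z₀, z₀ ∈ zeroes g ∨ z₀ ∈ poles g → IsAlgebraic ℚ (f z₀) := fun z₀ h =>
      (hg.divisor_algebraic z₀ (by simp only [Finset.mem_union]; exact h)).ringHom_of_comp_eq (RingHom.id ℚ) f
        (RingHom.id ℚ).injective (Subsingleton.elim _ _)
    rcases hz with ⟨z₀, hz₀, rfl⟩ | ⟨z₀, hz₀, rfl⟩
    · exact halg z₀ (Or.inl hz₀)
    · exact halg z₀ (Or.inr hz₀)
  · -- avoids the critical points
    refine ⟨fun e he => ?_, fun e he => ?_, ?_⟩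
    · rw [hn, eval_map_of_fixed τ _ (toGeom_fixed S τ he)]
      simpa using hg.avoids.num_eval_ne e he
    · rw [hd, eval_map_of_fixed τ _ (toGeom_fixed S τ he)]
      simpa using hg.avoids.denom_eval_ne e he
    · rw [hn, hd, Polynomial.natDegree_map, Polynomial.natDegree_map]
      exact hg.avoids.natDegree_eq
  · -- roots of unity at the critical points
    intro e he
    obtain ⟨n, hn0, hroot⟩ := hg.rootOfUnity_at_critical e he
    refine ⟨n, hn0, ?_⟩
    rw [eval_conjRat_of_fixed τ g (toGeom_fixed S τ he), ← map_pow, hroot, map_one]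

/-! ### 3. The carriers are `G_L^{rat}`-stable -/

variable (S : CriticalLocus L)

/-- **`𝕄_{∞κv}` is `π₁^{rat}`-stable** (model): `σ` maps an `∞κ`-coric element of `Λ_L` to an `∞κ`-coric element.
([IUTchI] Def 5.2 (v) p.135) [claim: Mochizuki2012, status: disputed] -/
theorem smul_mem_minfkSet (σ : ratGalois L) {x : ratClosure L} (hx : x ∈ S.minfkSet) : σ • x ∈ S.minfkSet := by
  rw [mem_minfkSet_iff] at hx ⊢
  obtain ⟨n, hn, g, hg, hxg⟩ := hx
  refine ⟨n, hn, conjRat (resConstants L σ) g, isKappaCoric_conjRat S _ hg, ?_⟩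
  rw [AlgEquiv.smul_def, ← map_pow, hxg, smul_geomEmb]

/-- **`𝕄_{∞κ×v}` is `π₁^{rat}`-stable** (model): `σ` fixes the unit constants `c ∈ U ⊆ L`.
([IUTchI] Def 5.2 (v) p.135) [claim: Mochizuki2012, status: disputed] -/
theorem smul_mem_minfkxSet (U : Set L) (σ : ratGalois L) {x : ratClosure L} (hx : x ∈ S.minfkxSet U) :
    σ • x ∈ S.minfkxSet U := by
  rw [mem_minfkxSet_iff] at hx ⊢
  obtain ⟨c, hc, h⟩ := hx
  refine ⟨c, hc, ?_⟩
  have := S.smul_mem_minfkSet σ h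
  rwa [smul_mul', AlgEquiv.smul_def σ (geomEmb L _), geomEmb_C_algebraMap, smul_algebraMap_base,
    ← geomEmb_C_algebraMap] at this

/-! ### 4. The kit -/

omit [CharZero L] in
/-- `G_L^{rat}` of the TYPE file IS GAP B item GB-01's `RatGal L` (both are `AlgebraicClosure (RatFunc L) ≃ₐ[RatFunc L] _`;
definitional). ([IUTchI] Def 5.2 (v) p.135) [claim: Mochizuki2012, status: disputed] -/
theorem ratGalois_eq_ratGal : ratGalois L = RatGal L := rfl

/-- `0 ∉ 𝕄_{∞κv}`: `0ⁿ = 0` is the image of `0 ∈ L̄(t)` only, which is not `κ`-coric (GB-01's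
`not_isKappaCoric_zero`). ([IUTchI] Rmk 3.1.7 (ii) p.67) [claim: Mochizuki2012, status: disputed] -/
theorem zero_notMem_minfkSet : (0 : ratClosure L) ∉ S.minfkSet := by
  rw [mem_minfkSet_iff]
  rintro ⟨n, hn, g, hg, h0⟩
  rw [zero_pow hn.ne', eq_comm, map_eq_zero_iff _ (geomEmb_injective L)] at h0
  exact S.toGeom.not_isKappaCoric_zero (h0 ▸ hg)

/-- `0 ∉ 𝕄_{∞κ×v}`. ([IUTchI] Rmk 3.1.7 (ii) p.67) [claim: Mochizuki2012, status: disputed] -/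
theorem zero_notMem_minfkxSet (U : Set L) : (0 : ratClosure L) ∉ S.minfkxSet U := by
  rw [mem_minfkxSet_iff]
  rintro ⟨c, -, hc⟩
  rw [mul_zero] at hc
  exact S.zero_notMem_minfkSet hc

/-- **The `∞κ×`-coric structure `π₁^{rat}(‡𝒟_v) ↷ 𝕄_{∞κ×v}` as a coric pair** (model): GB-01's constructor
`CoricPair.ofStableSet` BY NAME at the `G_L^{rat}`-stable set `𝕄_{∞κ×v} ⊆ Λ_L` — carrier `𝕄_{∞κ×v}`, partial
multiplication = the multiplication of `Λ_L` restricted to the pairs whose product stays in `𝕄_{∞κ×v}` (§0 p. 33),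
action = the Galois action (open stabilisers in the Krull topology). ([IUTchI] Def 5.2 (v) p.135)
[claim: Mochizuki2012, status: disputed] -/
abbrev minfkxCoricPair (U : Set L) : CoricPair (ratGalois L) :=
  CoricPair.ofStableSet (RatFunc L) (ratClosure L) (S.minfkxSet U) (fun σ _ hx => S.smul_mem_minfkxSet U σ hx)

/-- The action on the pair is the Galois action. ([IUTchI] Def 5.2 (v) p.135) [claim: Mochizuki2012, status: disputed] -/
theorem coe_smul_minfkxCoricPair (U : Set L) (σ : ratGalois L) (x : (S.minfkxCoricPair U).carrier) :
    ((σ • x : (S.minfkxCoricPair U).carrier) : ratClosure L) = σ (x : ratClosure L) := rfl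

/-- The `∞κ×`-pair is a pseudo-monoid in the sense of [IUTchI] §0 p. 33 (realised in `Λ_Lˣ`; `0 ∉ 𝕄_{∞κ×v}`).
([IUTchI] Def 5.2 (v) p.135) [claim: Mochizuki2012, status: disputed] -/
theorem isPseudoMonoid_minfkxCoricPair (U : Set L) : (S.minfkxCoricPair U).pm.IsPseudoMonoid :=
  CoricPair.isPseudoMonoid_ofStableSet _ (S.zero_notMem_minfkxSet U)

/-- **GAP-SIZING-B.md row D2 — the t4-shape `∞κ`-coric KIT of the local layer** `π₁^{rat}(‡𝒟_v) ↷ 𝕄_{∞κ×v} ⊇ 𝕄_{∞κv}`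
at the model: `infkx` = the `∞κ×`-coric pair with unit parameter `U` (print: `U := 𝒪^×`), `infk` = its `∞κ`-coric
elements (a `π₁^{rat}`-stable subset; `Minfk ⊆ Minfkx` by construction, and `= 𝕄_{∞κv}` as soon as `1 ∈ U`,
`exists_infk_of_mem_minfkSet`). ([IUTchI] Def 5.2 (v) p.135) [claim: Mochizuki2012, status: disputed] -/
abbrev infKappaCoricKit (U : Set L) : InfKappaCoricKit (ratGalois L) where
  infkx := S.minfkxCoricPair U
  infk := ⟨{f | (f : ratClosure L) ∈ S.minfkSet}, fun σ _ hf => S.smul_mem_minfkSet σ hf⟩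

/-- Membership in the kit's `𝕄_{∞κv}`: an element of `𝕄_{∞κ×v}` that is `∞κ`-coric. ([IUTchI] Def 5.2 (v) p.135)
[claim: Mochizuki2012, status: disputed] -/
theorem mem_infKappaCoricKit_infk_iff (U : Set L) (f : (S.infKappaCoricKit U).infkx.carrier) :
    f ∈ (S.infKappaCoricKit U).infk ↔ (f : ratClosure L) ∈ S.minfkSet := Iff.rfl

/-- The kit's `𝕄_{∞κ×v}` IS `𝕄_{∞κ×v} ⊆ Λ_L`. ([IUTchI] Def 5.2 (v) p.135) [claim: Mochizuki2012, status: disputed] -/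
theorem coe_mem_minfkxSet (U : Set L) (f : (S.infKappaCoricKit U).infkx.carrier) :
    (f : ratClosure L) ∈ S.minfkxSet U := f.2

/-- When `1 ∈ U` (e.g. `U = 𝒪^×`), the kit's `𝕄_{∞κv}` is ALL of `𝕄_{∞κv} ⊆ Λ_L`: every `∞κ`-coric element is
`∞κ×`-coric. ([IUTchI] Def 5.2 (v) p.135) [claim: Mochizuki2012, status: disputed] -/
theorem exists_infk_of_mem_minfkSet {U : Set L} (hU : (1 : L) ∈ U) {x : ratClosure L} (hx : x ∈ S.minfkSet) :
    ∃ f : (S.infKappaCoricKit U).infkx.carrier, f ∈ (S.infKappaCoricKit U).infk ∧ (f : ratClosure L) = x :=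
  ⟨⟨x, S.minfkSet_subset_minfkxSet hU hx⟩, hx, rfl⟩

/-- The kit's `𝕄_{κv}` (invariants of `𝕄_{∞κv}`), unfolded at the model: `∞κ`-coric elements of `Λ_L` fixed by
`Gal(Λ_L/L(t))`. ([IUTchI] Def 5.2 (v) p.135) [claim: Mochizuki2012, status: disputed] -/
theorem mem_infKappaCoricKit_kappa_iff (U : Set L) (f : (S.infKappaCoricKit U).infkx.carrier) :
    f ∈ (S.infKappaCoricKit U).kappa ↔
      (f : ratClosure L) ∈ S.minfkSet ∧ ∀ σ : ratGalois L, σ (f : ratClosure L) = f := by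
  rw [InfKappaCoricKit.mem_kappa_iff, mem_infKappaCoricKit_infk_iff]
  refine and_congr Iff.rfl (forall_congr' fun σ => ?_)
  rw [← coe_smul_minfkxCoricPair]
  exact ⟨fun h => by rw [h], fun h => Subtype.ext h⟩

/-- The kit's `∞κ×`-pair is a pseudo-monoid ([IUTchI] §0). ([IUTchI] Def 5.2 (v) p.135)
[claim: Mochizuki2012, status: disputed] -/
theorem isPseudoMonoid_infKappaCoricKit (U : Set L) : (S.infKappaCoricKit U).infkx.pm.IsPseudoMonoid :=
  S.isPseudoMonoid_minfkxCoricPair U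

end CriticalLocus

/-- **The local `∞κ`-coric layer of a field `L`, bundled**: `π₁^{rat} := Gal(Λ_L/L(t))` with its Krull topology and the
kit `CriticalLocus.infKappaCoricKit S U` (the shape consumed by `S5Local.InfKappaLink.loc*`).
([IUTchI] Def 5.2 (v) p.135) [claim: Mochizuki2012, status: disputed] -/
abbrev LocalInfKappaLayer.ofField (L : Type u) [Field L] [CharZero L] (S : CriticalLocus L) (U : Set L) :
    LocalInfKappaLayer.{u} where
  rat := CriticalLocus.ratGalois L
  kit := S.infKappaCoricKit U

/-- The group of `LocalInfKappaLayer.ofField` is `Gal(Λ_L/L(t))`. ([IUTchI] Def 5.2 (v) p.135)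
[claim: Mochizuki2012, status: disputed] -/
theorem LocalInfKappaLayer.ofField_rat (L : Type u) [Field L] [CharZero L] (S : CriticalLocus L) (U : Set L) :
    (LocalInfKappaLayer.ofField L S U).rat = CriticalLocus.ratGalois L := rfl

end Literature.IUT.HodgeTheaters

end
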